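import Literature.AnabelianGeometry.EtaleTheta.Discharge.Sec2Cor218ivSurjectiveCoreNecessity
import Literature.AnabelianGeometry.EtaleTheta.Discharge.Sec2Cor218iCoreClauses
import Literature.AnabelianGeometry.EtaleTheta.Discharge.Sec2Cor218Cor219AtModelChi
import Literature.AnabelianGeometry.EtaleTheta.Discharge.Sec2Cor219iAtModelChi
import Literature.AnabelianGeometry.EtaleTheta.Discharge.Sec2Cor218ivAllLevels
import HarnessLib

/-!
# [EtTh] Cor 2.18 (iv) / Cor 2.19 (ii) for the §1 model and at the record model `modelχ`: the cusp-LABEL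
# clause of Cor 2.18 (i) is IDLE in the whole chain, the `Π^tp_Ÿ`-clause is NOT (proof-only companion)

Mochizuki, *The Étale Theta Function and its Frobenioid-theoretic Manifestations* [EtTh], Publ. RIMS
45 (2009), §2: Cor 2.18 (i) p.60, (iv) pp.61–63, Cor 2.19 (ii), (iii) pp.64–66 (locators `p.N` = PDF
pages of the PRIMS text; bib key `MochizukiEtTh2009`). PROOF-ONLY (no `def`, no instance, no new named
fact); cell abc-iut, block F, seat abc-iut-f-147 (gen 3), F-TRANCHES tranche 147 (row F-0625
`RigidData.Cor218_iv_surjective`); companion of `Sec2Cor218ivSurjectiveCoreNecessity.lean`.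

STATE OF RECORD. The lane-C2 capstones for abc-iut-L2-t8's §1 → §2 adapter `C.rigidData μ hC hS h15 L`
"down to the FACT-policy floor" — abc-iut-L2-t10's `rigidData_cor218_iv_surjective_modAll` (Cor 2.18
(iv), surjectivity, at EVERY level `M ∈ ℕ≥1`), abc-iut-L2-d1's `cor219_ii_model_of_facts` (Cor 2.19 (ii),
discrete rigidity), abc-iut-f-153's `cor218_iv_bijective_of_odd_of_model_of_facts`, abc-iut-f-150's
`exists_iso_of_systems_model_of_facts` and their record-model forms `SettingModel.*_modelχ_of_facts` —
all bind `h218i : ∀ M, (C.rigidData (τ.mod M) hC hS h15 L).Cor218_i` at the consumer's labelling `L`.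
abc-iut-f-148 (`Sec2Cor218iCoreClauses.lean`): whenever `Π^tp_X` is temp-slim — at `modelχ` always
(`SettingModel.not_forall_cuspLabels_cor218_i_modelχ`) — that binder is UNSATISFIABLE at some `L`
(the label clause fails at a perverse labelling), while at the EMPTY labelling `Cor218_i` IS its five
`L`-free clauses (`cor218_i_emptyLabels_iff`).

THIS FILE (kernel census, by instantiation at the empty labelling — the conclusions and the five
`L`-free clauses do not depend on `L`, definitionally):
* §1 (any theta setting `D`): `rigidData_cor218_iv_surjective_iff_of_cuspLabels` (label-independence,
  `Iff.rfl`); `rigidData_core5_of_extends` (the five `L`-free clauses from "every `γ ∈ Aut_top(Π^tp_X̲̲)`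
  extends to a `Δ^tp_X`- and `Π^tp_Ÿ`-stabilising `Γ ∈ Aut_top(Π^tp_X)`" — abc-iut-L2-d1's
  `rigidData_cor218_i_of_extends` minus `hcusp`); the four capstones re-cut with the binder
  `hcore5 : ∀ M γ, five L-free clauses` in place of `h218i` — `rigidData_cor218_iv_surjective_modAll_of_core5`,
  `cor219_ii_model_of_core5_facts`, `cor218_iv_bijective_of_odd_of_model_of_core5_facts`,
  `exists_iso_of_systems_model_of_core5_facts` — and with `hext` (`…_of_extends…`).
* §2 (the record model `D := ThetaSetting.modelχ p`, where moreover the `Π^tp_Y`-clause is a THEOREM,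
  abc-iut-f-148's `SettingModel.rigidData_map_PiY_eq_modelχ`): `SettingModel.cor219_ii_modelχ_of_extends_facts`,
  `SettingModel.rigidData_cor218_iv_surjective_modAll_modelχ_of_extends`,
  `SettingModel.cor218_iv_bijective_of_odd_modelχ_of_extends_facts` — residual inputs EXACTLY: Prop 1.5
  (ii), (iii), the extension property `hext` (anabelian input, label-free) and the named fact
  `ThetaEnvTower.Cor219_iii` (constant multiple rigidity).
* §3 CONVERSELY the `Π^tp_Ÿ`-clause is NOT idle: `SettingModel.map_PiYdd_eq_of_cor218_iv_surjective_modelχ`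
  — at `modelχ`, Cor 2.18 (iv) surjectivity at any level forces EVERY `γ ∈ Aut_top(Π^tp_X̲̲)` to map
  `Π^tp_Ÿ̲̲` onto itself and to preserve the cyclotomic character on `Π^tp_Y̲̲` (abc-iut-f-147's
  `RigidData.necessary_of_cor218_iv_surjective`, the `Π^tp_Y̲̲`-hypothesis being automatic there).

HONEST FRAMING: hypothesis census in the kernel; the anabelian input (F-0620, here in its label-free
extension form), constant multiple rigidity and Prop 1.5 (ii), (iii) are NOT claimed; `modelχ` is a
semi-synthetic model (joint-satisfiability evidence for the binder set, not the tempered `π₁` of a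
curve); nothing of [EtTh] (refereed) is asserted or disputed; no side is taken on [IUTchIII] Cor 3.12;
typed ≠ proved; a FACT row is an assumption label, not an endorsement.
-/

noncomputable section

namespace Literature.AnabelianGeometry.EtaleTheta

open Literature.AnabelianGeometry.SemiGraphs
open Literature.AlgebraicGeometry.Frobenioids (IsSlimGroup)

/-! ## §1. The §1 → §2 adapter over any theta setting: capstones with the `L`-free core as binder -/

namespace ThetaSetting.EtaleThetaData.DoubleUnderline

variable {p : ℕ} [Fact p.Prime] {D : ThetaSetting p} {E : D.EtaleThetaData} {l : ℕ}
  (C : E.DoubleUnderline l) {Es : Set ℕ+} (τ : D.CyclotomeTower l Es)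

/-- **Cor 2.18 (iv), surjectivity, for the adapter does not depend on the cusp labels** (the statement
only involves the `ThetaEnvData` part of the rigidity data): definitionally the same proposition at any
two labellings. [cite: MochizukiEtTh2009, Cor 2.18(iv) p.61] -/
theorem rigidData_cor218_iv_surjective_iff_of_cuspLabels {N : ℕ+} (μ : D.CyclotomeMod l N)
    (hC : D.Compat) (hS : D.Sec2Hyps) (h15 : Prop15iii E hC) (L L' : C.CuspLabels) :
    (C.rigidData μ hC hS h15 L).Cor218_iv_surjective ↔
      (C.rigidData μ hC hS h15 L').Cor218_iv_surjective :=
  Iff.rfl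

/-- **The five `L`-free clauses of Cor 2.18 (i) at the adapter from EXTENSION**: if `γ ∈ Aut_top(Π^tp_X̲̲)`
is the restriction of some `Γ ∈ Aut_top(Π^tp_X)` stabilising `Δ^tp_X` and `Π^tp_Ÿ`, then `γ` preserves
`Π^tp_Y̲̲`, `Π^tp_Ÿ̲̲`, `Δ_X̲̲`, `Ker(Π^tp_X̲̲ → (Π^tp_X)^Θ)` and `l·Δ_Θ` — abc-iut-L2-d1's
`rigidData_cor218_i_of_extends` without its label hypothesis `hcusp` (the `Π^tp_Y`-clause via
`map_GtpY_eq_of_map_GtpYdd_eq`). [cite: MochizukiEtTh2009, Cor 2.18(i) p.60] -/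
theorem rigidData_core5_of_extends {N : ℕ+} (μ : D.CyclotomeMod l N) (hC : D.Compat)
    (hS : D.Sec2Hyps) (h15 : Prop15iii E hC) (L : C.CuspLabels)
    (hext : ∀ γ : ↥C.Huu ≃ₜ* ↥C.Huu, ∃ Γ : D.PiTemp ≃ₜ* D.PiTemp,
      (∀ h : C.Huu, Γ (h : D.PiTemp) = ((γ h : C.Huu) : D.PiTemp)) ∧
      D.DeltaTemp.map Γ.toMulEquiv.toMonoidHom = D.DeltaTemp ∧
      D.GtpYdd.map Γ.toMulEquiv.toMonoidHom = D.GtpYdd)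
    (γ : ↥C.Huu ≃ₜ* ↥C.Huu) :
    (C.rigidData μ hC hS h15 L).PiY.map γ.toMulEquiv.toMonoidHom = (C.rigidData μ hC hS h15 L).PiY ∧
      (C.rigidData μ hC hS h15 L).PiYdd.map γ.toMulEquiv.toMonoidHom =
        (C.rigidData μ hC hS h15 L).PiYdd ∧
      (C.rigidData μ hC hS h15 L).aug.ker.map γ.toMulEquiv.toMonoidHom =
        (C.rigidData μ hC hS h15 L).aug.ker ∧
      (C.rigidData μ hC hS h15 L).thetaKer.map γ.toMulEquiv.toMonoidHom =
        (C.rigidData μ hC hS h15 L).thetaKer ∧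
      (C.rigidData μ hC hS h15 L).lDeltaTheta.map γ.toMulEquiv.toMonoidHom =
        (C.rigidData μ hC hS h15 L).lDeltaTheta := by
  obtain ⟨Γ, hΓ, hΔ, hYdd⟩ := hext γ
  have hY := D.map_GtpY_eq_of_map_GtpYdd_eq hS Γ hYdd
  exact ⟨C.map_subgroupOf_Huu_eq_of_extends γ Γ hΓ _ hY, C.map_subgroupOf_Huu_eq_of_extends γ Γ hΓ _ hYdd,
    C.rigidData_augKer_map_eq_of_extends μ hC hS h15 L γ Γ hΓ hΔ,
    C.rigidData_thetaKer_map_eq_of_extends μ hC hS h15 L γ Γ hΓ hΔ,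
    C.rigidData_lDeltaTheta_map_eq_of_extends μ hC hS h15 L γ Γ hΓ hΔ⟩

/-- At the EMPTY labelling, the five `L`-free clauses (read at ANY labelling `L` — they do not involve
`L`) give the full `Cor218_i`. [cite: MochizukiEtTh2009, Cor 2.18(i) p.60] -/
theorem rigidData_cor218_i_emptyLabels_of_core5 {N : ℕ+} (μ : D.CyclotomeMod l N) (hC : D.Compat)
    (hS : D.Sec2Hyps) (h15 : Prop15iii E hC) (L : C.CuspLabels)
    (hcore5 : ∀ γ : ↥C.Huu ≃ₜ* ↥C.Huu,
      (C.rigidData μ hC hS h15 L).PiY.map γ.toMulEquiv.toMonoidHom = (C.rigidData μ hC hS h15 L).PiY ∧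
      (C.rigidData μ hC hS h15 L).PiYdd.map γ.toMulEquiv.toMonoidHom =
        (C.rigidData μ hC hS h15 L).PiYdd ∧
      (C.rigidData μ hC hS h15 L).aug.ker.map γ.toMulEquiv.toMonoidHom =
        (C.rigidData μ hC hS h15 L).aug.ker ∧
      (C.rigidData μ hC hS h15 L).thetaKer.map γ.toMulEquiv.toMonoidHom =
        (C.rigidData μ hC hS h15 L).thetaKer ∧
      (C.rigidData μ hC hS h15 L).lDeltaTheta.map γ.toMulEquiv.toMonoidHom =
        (C.rigidData μ hC hS h15 L).lDeltaTheta) :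
    (C.rigidData μ hC hS h15 ⟨fun _ => ∅, fun _ => ∅, fun _ => rfl⟩).Cor218_i :=
  (C.cor218_i_emptyLabels_iff μ hC hS h15).2 hcore5

/-- **[EtTh] Cor 2.18 (iv), surjectivity, for the §1 model at EVERY level `M ∈ ℕ≥1`, with the `L`-free core
as binder**: abc-iut-L2-t10's `rigidData_cor218_iv_surjective_modAll` re-cut — the hypothesis is the five
label-free clauses of Cor 2.18 (i) at the chain levels (for every `γ ∈ Aut_top(Π^tp_X̲̲)`), the named fact
`ThetaEnvTower.Cor219_iii` and Prop 1.5 (ii), (iii); no cusp-label clause.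
[cite: MochizukiEtTh2009, Cor 2.18(iv) p.61] -/
theorem rigidData_cor218_iv_surjective_modAll_of_core5 (M : ℕ+) (hC : D.Compat) (hS : D.Sec2Hyps)
    (h15 : Prop15iii E hC) (h15ii : Prop15ii E.toKummerData hC) (L : C.CuspLabels)
    (hcore5 : ∀ (e : Es) (γ : ↥C.Huu ≃ₜ* ↥C.Huu),
      (C.rigidData (τ.mod e) hC hS h15 L).PiY.map γ.toMulEquiv.toMonoidHom =
        (C.rigidData (τ.mod e) hC hS h15 L).PiY ∧
      (C.rigidData (τ.mod e) hC hS h15 L).PiYdd.map γ.toMulEquiv.toMonoidHom =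
        (C.rigidData (τ.mod e) hC hS h15 L).PiYdd ∧
      (C.rigidData (τ.mod e) hC hS h15 L).aug.ker.map γ.toMulEquiv.toMonoidHom =
        (C.rigidData (τ.mod e) hC hS h15 L).aug.ker ∧
      (C.rigidData (τ.mod e) hC hS h15 L).thetaKer.map γ.toMulEquiv.toMonoidHom =
        (C.rigidData (τ.mod e) hC hS h15 L).thetaKer ∧
      (C.rigidData (τ.mod e) hC hS h15 L).lDeltaTheta.map γ.toMulEquiv.toMonoidHom =
        (C.rigidData (τ.mod e) hC hS h15 L).lDeltaTheta)
    (h219iii : (C.thetaEnvTower τ hC hS).Cor219_iii) :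
    (C.rigidData (τ.modAll M) hC hS h15 L).Cor218_iv_surjective :=
  C.rigidData_cor218_iv_surjective_modAll τ M hC hS h15 h15ii ⟨fun _ => ∅, fun _ => ∅, fun _ => rfl⟩
    (fun e => C.rigidData_cor218_i_emptyLabels_of_core5 (τ.mod e) hC hS h15 L (hcore5 e)) h219iii

/-- **The same with the core supplied by EXTENSION** (`Δ^tp_X`- and `Π^tp_Ÿ`-stabilising extensions of
every `γ ∈ Aut_top(Π^tp_X̲̲)`). [cite: MochizukiEtTh2009, Cor 2.18(iv) p.61] -/
theorem rigidData_cor218_iv_surjective_modAll_of_extends (M : ℕ+) (hC : D.Compat) (hS : D.Sec2Hyps)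
    (h15 : Prop15iii E hC) (h15ii : Prop15ii E.toKummerData hC) (L : C.CuspLabels)
    (hext : ∀ γ : ↥C.Huu ≃ₜ* ↥C.Huu, ∃ Γ : D.PiTemp ≃ₜ* D.PiTemp,
      (∀ h : C.Huu, Γ (h : D.PiTemp) = ((γ h : C.Huu) : D.PiTemp)) ∧
      D.DeltaTemp.map Γ.toMulEquiv.toMonoidHom = D.DeltaTemp ∧
      D.GtpYdd.map Γ.toMulEquiv.toMonoidHom = D.GtpYdd)
    (h219iii : (C.thetaEnvTower τ hC hS).Cor219_iii) :
    (C.rigidData (τ.modAll M) hC hS h15 L).Cor218_iv_surjective :=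
  C.rigidData_cor218_iv_surjective_modAll_of_core5 τ M hC hS h15 h15ii L
    (fun e => C.rigidData_core5_of_extends (τ.mod e) hC hS h15 L hext) h219iii

/-- **[EtTh] Cor 2.19 (ii) (discrete rigidity) for the §1 model, with the `L`-free core as binder**:
abc-iut-L2-d1's `cor219_ii_model_of_facts` re-cut — residual inputs: Prop 1.5 (ii), (iii), temp-slimness
of `Π^tp_X`, `IsOpenMap aug`, the five label-free clauses of Cor 2.18 (i) at the chain levels,
`ThetaEnvTower.Cor219_iii`, `IsEtThOrigin`, `hYcl`; no cusp-label clause.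
[cite: MochizukiEtTh2009, Cor 2.19(ii) p.64] -/
theorem cor219_ii_model_of_core5_facts (hC : D.Compat) (hS : D.Sec2Hyps) (h15 : Prop15iii E hC)
    (h15ii : Prop15ii E.toKummerData hC) (L : C.CuspLabels) (hslimX : IsSlimGroup D.PiTemp)
    (haugOpen : IsOpenMap D.aug)
    (hcore5 : ∀ (e : Es) (γ : ↥C.Huu ≃ₜ* ↥C.Huu),
      (C.rigidData (τ.mod e) hC hS h15 L).PiY.map γ.toMulEquiv.toMonoidHom =
        (C.rigidData (τ.mod e) hC hS h15 L).PiY ∧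
      (C.rigidData (τ.mod e) hC hS h15 L).PiYdd.map γ.toMulEquiv.toMonoidHom =
        (C.rigidData (τ.mod e) hC hS h15 L).PiYdd ∧
      (C.rigidData (τ.mod e) hC hS h15 L).aug.ker.map γ.toMulEquiv.toMonoidHom =
        (C.rigidData (τ.mod e) hC hS h15 L).aug.ker ∧
      (C.rigidData (τ.mod e) hC hS h15 L).thetaKer.map γ.toMulEquiv.toMonoidHom =
        (C.rigidData (τ.mod e) hC hS h15 L).thetaKer ∧
      (C.rigidData (τ.mod e) hC hS h15 L).lDeltaTheta.map γ.toMulEquiv.toMonoidHom =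
        (C.rigidData (τ.mod e) hC hS h15 L).lDeltaTheta)
    (h219iii : (C.thetaEnvTower τ hC hS).Cor219_iii) (hO : D.IsEtThOrigin)
    (hYcl : (D.DtpY.map D.toHat.toMonoidHom).topologicalClosure ≤
      D.DtpY.map D.toHat.toMonoidHom ⊔ (⁅⁅D.DeltaHat, D.DeltaHat⁆, D.DeltaHat⁆).topologicalClosure) :
    ThetaEnvTower.Cor219_ii (C.thetaEnvTower τ hC hS) :=
  C.cor219_ii_model_of_facts τ hC hS h15 h15ii ⟨fun _ => ∅, fun _ => ∅, fun _ => rfl⟩ hslimX haugOpen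
    (fun e => C.rigidData_cor218_i_emptyLabels_of_core5 (τ.mod e) hC hS h15 L (hcore5 e)) h219iii hO hYcl

/-- **Cor 2.19 (ii) for the §1 model with the core from EXTENSION.** [cite: MochizukiEtTh2009, Cor 2.19(ii) p.64] -/
theorem cor219_ii_model_of_extends_facts (hC : D.Compat) (hS : D.Sec2Hyps) (h15 : Prop15iii E hC)
    (h15ii : Prop15ii E.toKummerData hC) (L : C.CuspLabels) (hslimX : IsSlimGroup D.PiTemp)
    (haugOpen : IsOpenMap D.aug)
    (hext : ∀ γ : ↥C.Huu ≃ₜ* ↥C.Huu, ∃ Γ : D.PiTemp ≃ₜ* D.PiTemp,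
      (∀ h : C.Huu, Γ (h : D.PiTemp) = ((γ h : C.Huu) : D.PiTemp)) ∧
      D.DeltaTemp.map Γ.toMulEquiv.toMonoidHom = D.DeltaTemp ∧
      D.GtpYdd.map Γ.toMulEquiv.toMonoidHom = D.GtpYdd)
    (h219iii : (C.thetaEnvTower τ hC hS).Cor219_iii) (hO : D.IsEtThOrigin)
    (hYcl : (D.DtpY.map D.toHat.toMonoidHom).topologicalClosure ≤
      D.DtpY.map D.toHat.toMonoidHom ⊔ (⁅⁅D.DeltaHat, D.DeltaHat⁆, D.DeltaHat⁆).topologicalClosure) :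
    ThetaEnvTower.Cor219_ii (C.thetaEnvTower τ hC hS) :=
  C.cor219_ii_model_of_core5_facts τ hC hS h15 h15ii L hslimX haugOpen
    (fun e => C.rigidData_core5_of_extends (τ.mod e) hC hS h15 L hext) h219iii hO hYcl

/-- **[EtTh] Cor 2.18 (iv), bijectivity for `N/M` odd (tower form), for the §1 model with the `L`-free
core as binder**: abc-iut-f-153's `cor218_iv_bijective_of_odd_of_model_of_facts` re-cut; no cusp-label
clause. [cite: MochizukiEtTh2009, Cor 2.18(iv) p.62] -/
theorem cor218_iv_bijective_of_odd_of_model_of_core5_facts (hC : D.Compat) (hS : D.Sec2Hyps)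
    (h15 : Prop15iii E hC) (h15ii : Prop15ii E.toKummerData hC) (L : C.CuspLabels)
    (hslimX : IsSlimGroup D.PiTemp) (haugOpen : IsOpenMap D.aug)
    (hcore5 : ∀ (e : Es) (γ : ↥C.Huu ≃ₜ* ↥C.Huu),
      (C.rigidData (τ.mod e) hC hS h15 L).PiY.map γ.toMulEquiv.toMonoidHom =
        (C.rigidData (τ.mod e) hC hS h15 L).PiY ∧
      (C.rigidData (τ.mod e) hC hS h15 L).PiYdd.map γ.toMulEquiv.toMonoidHom =
        (C.rigidData (τ.mod e) hC hS h15 L).PiYdd ∧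
      (C.rigidData (τ.mod e) hC hS h15 L).aug.ker.map γ.toMulEquiv.toMonoidHom =
        (C.rigidData (τ.mod e) hC hS h15 L).aug.ker ∧
      (C.rigidData (τ.mod e) hC hS h15 L).thetaKer.map γ.toMulEquiv.toMonoidHom =
        (C.rigidData (τ.mod e) hC hS h15 L).thetaKer ∧
      (C.rigidData (τ.mod e) hC hS h15 L).lDeltaTheta.map γ.toMulEquiv.toMonoidHom =
        (C.rigidData (τ.mod e) hC hS h15 L).lDeltaTheta)
    (h219iii : (C.thetaEnvTower τ hC hS).Cor219_iii) (hO : D.IsEtThOrigin)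
    (hYcl : (D.DtpY.map D.toHat.toMonoidHom).topologicalClosure ≤
      D.DtpY.map D.toHat.toMonoidHom ⊔ (⁅⁅D.DeltaHat, D.DeltaHat⁆, D.DeltaHat⁆).topologicalClosure) :
    (C.thetaEnvTower τ hC hS).Cor218_iv_bijective_of_odd :=
  C.cor218_iv_bijective_of_odd_of_model_of_facts τ hC hS h15 h15ii ⟨fun _ => ∅, fun _ => ∅, fun _ => rfl⟩
    hslimX haugOpen
    (fun e => C.rigidData_cor218_i_emptyLabels_of_core5 (τ.mod e) hC hS h15 L (hcore5 e)) h219iii hO hYcl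

/-- **Cor 2.19 (ii), STRONG form, for the §1 model with the `L`-free core as binder** (every projective
system of mono-theta environments is isomorphic, compatibly with the reductions, to the natural system
of ANY compatible family of theta cocycles): abc-iut-f-150's `exists_iso_of_systems_model_of_facts`
re-cut; no cusp-label clause. [cite: MochizukiEtTh2009, Cor 2.19(ii) p.64] -/
theorem exists_iso_of_systems_model_of_core5_facts (hC : D.Compat) (hS : D.Sec2Hyps)
    (h15 : Prop15iii E hC) (h15ii : Prop15ii E.toKummerData hC) (L : C.CuspLabels)
    (hslimX : IsSlimGroup D.PiTemp) (haugOpen : IsOpenMap D.aug)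
    (hcore5 : ∀ (e : Es) (γ : ↥C.Huu ≃ₜ* ↥C.Huu),
      (C.rigidData (τ.mod e) hC hS h15 L).PiY.map γ.toMulEquiv.toMonoidHom =
        (C.rigidData (τ.mod e) hC hS h15 L).PiY ∧
      (C.rigidData (τ.mod e) hC hS h15 L).PiYdd.map γ.toMulEquiv.toMonoidHom =
        (C.rigidData (τ.mod e) hC hS h15 L).PiYdd ∧
      (C.rigidData (τ.mod e) hC hS h15 L).aug.ker.map γ.toMulEquiv.toMonoidHom =
        (C.rigidData (τ.mod e) hC hS h15 L).aug.ker ∧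
      (C.rigidData (τ.mod e) hC hS h15 L).thetaKer.map γ.toMulEquiv.toMonoidHom =
        (C.rigidData (τ.mod e) hC hS h15 L).thetaKer ∧
      (C.rigidData (τ.mod e) hC hS h15 L).lDeltaTheta.map γ.toMulEquiv.toMonoidHom =
        (C.rigidData (τ.mod e) hC hS h15 L).lDeltaTheta)
    (h219iii : (C.thetaEnvTower τ hC hS).Cor219_iii) (hO : D.IsEtThOrigin)
    (hYcl : (D.DtpY.map D.toHat.toMonoidHom).topologicalClosure ≤
      D.DtpY.map D.toHat.toMonoidHom ⊔ (⁅⁅D.DeltaHat, D.DeltaHat⁆, D.DeltaHat⁆).topologicalClosure)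
    (S : (C.thetaEnvTower τ hC hS).MTESystem)
    (η₀ : ∀ M : Es, (C.thetaEnvTower τ hC hS).PiYdd → (C.thetaEnvTower τ hC hS).mu M)
    (hη₀ : ∀ M, η₀ M ∈ (C.thetaEnvTower τ hC hS).thetaCocycles M)
    (hη₀c : ∀ (M M' : Es) (h : (M : ℕ+) ∣ M'), (C.thetaEnvTower τ hC hS).red M M' h ∘ η₀ M' = η₀ M) :
    ∃ α : ∀ M : Es, (((C.thetaEnvTower τ hC hS).level M).modelMono (hη₀ M)).Iso
        (((C.thetaEnvTower τ hC hS).level M).modelMono (S.mem M)),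
      ∀ (M M' : Es) (h : (M : ℕ+) ∣ M') (x : ((C.thetaEnvTower τ hC hS).level M').env),
        S.a M M' h ((C.thetaEnvTower τ hC hS).redEnv M M' h ((α M').e x)) =
          (α M).e ((C.thetaEnvTower τ hC hS).redEnv M M' h x) :=
  C.exists_iso_of_systems_model_of_facts τ hC hS h15 h15ii ⟨fun _ => ∅, fun _ => ∅, fun _ => rfl⟩
    hslimX haugOpen
    (fun e => C.rigidData_cor218_i_emptyLabels_of_core5 (τ.mod e) hC hS h15 L (hcore5 e))
    h219iii hO hYcl S η₀ hη₀ hη₀c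

end ThetaSetting.EtaleThetaData.DoubleUnderline

/-! ## §2. At the record model `modelχ p`: residual = {Prop 1.5 (ii), (iii), extension, Cor 2.19 (iii)} -/

namespace SettingModel

variable (p : ℕ) [Fact p.Prime]
variable {E : (ThetaSetting.modelχ p).EtaleThetaData} {l : ℕ} (C : E.DoubleUnderline l) {N : ℕ+}
  (μ : (ThetaSetting.modelχ p).CyclotomeMod l N) {Es : Set ℕ+}
  (τ : (ThetaSetting.modelχ p).CyclotomeTower l Es)

/-- **[EtTh] Cor 2.19 (ii) (discrete rigidity) at the record model tower, label-free**: the projective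
system of model mono-theta environments of `X̲̲` is rigid, conditional on EXACTLY Prop 1.5 (ii), (iii),
the extension property `hext` (every `γ ∈ Aut_top(Π^tp_X̲̲)` extends to a `Δ^tp_X`- and
`Π^tp_Ÿ`-stabilising `Γ ∈ Aut_top(Π^tp_X)` — the label-free anabelian input) and `ThetaEnvTower.Cor219_iii`
— abc-iut-f-150's `cor219_ii_modelχ_of_facts` without the (at some `L` unsatisfiable) binder
`∀ M, Cor218_i`. [cite: MochizukiEtTh2009, Cor 2.19(ii) p.64] -/
theorem cor219_ii_modelχ_of_extends_facts (hC : (ThetaSetting.modelχ p).Compat)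
    (hS : (ThetaSetting.modelχ p).Sec2Hyps) (h15 : ThetaSetting.Prop15iii E hC)
    (h15ii : ThetaSetting.Prop15ii E.toKummerData hC)
    (hext : ∀ γ : ↥C.Huu ≃ₜ* ↥C.Huu, ∃ Γ : (ThetaSetting.modelχ p).PiTemp ≃ₜ* (ThetaSetting.modelχ p).PiTemp,
      (∀ h : C.Huu, Γ (h : (ThetaSetting.modelχ p).PiTemp) = ((γ h : C.Huu) : (ThetaSetting.modelχ p).PiTemp)) ∧
      (ThetaSetting.modelχ p).DeltaTemp.map Γ.toMulEquiv.toMonoidHom = (ThetaSetting.modelχ p).DeltaTemp ∧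
      (ThetaSetting.modelχ p).GtpYdd.map Γ.toMulEquiv.toMonoidHom = (ThetaSetting.modelχ p).GtpYdd)
    (h219iii : (C.thetaEnvTower τ hC hS).Cor219_iii) :
    ThetaEnvTower.Cor219_ii (C.thetaEnvTower τ hC hS) :=
  cor219_ii_modelχ_of_facts p C τ hC hS h15 h15ii ⟨fun _ => ∅, fun _ => ∅, fun _ => rfl⟩
    (fun e => C.rigidData_cor218_i_emptyLabels_of_core5 (τ.mod e) hC hS h15
      ⟨fun _ => ∅, fun _ => ∅, fun _ => rfl⟩
      (fun γ => C.rigidData_core5_of_extends (τ.mod e) hC hS h15 _ hext γ)) h219iii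

/-- **[EtTh] Cor 2.18 (iv), surjectivity, at the record model at EVERY level `M ∈ ℕ≥1`, label-free**:
conditional on Prop 1.5 (ii), (iii), `hext` and `ThetaEnvTower.Cor219_iii` only.
[cite: MochizukiEtTh2009, Cor 2.18(iv) p.61] -/
theorem rigidData_cor218_iv_surjective_modAll_modelχ_of_extends (M : ℕ+)
    (hC : (ThetaSetting.modelχ p).Compat) (hS : (ThetaSetting.modelχ p).Sec2Hyps)
    (h15 : ThetaSetting.Prop15iii E hC) (h15ii : ThetaSetting.Prop15ii E.toKummerData hC)
    (L : C.CuspLabels)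
    (hext : ∀ γ : ↥C.Huu ≃ₜ* ↥C.Huu, ∃ Γ : (ThetaSetting.modelχ p).PiTemp ≃ₜ* (ThetaSetting.modelχ p).PiTemp,
      (∀ h : C.Huu, Γ (h : (ThetaSetting.modelχ p).PiTemp) = ((γ h : C.Huu) : (ThetaSetting.modelχ p).PiTemp)) ∧
      (ThetaSetting.modelχ p).DeltaTemp.map Γ.toMulEquiv.toMonoidHom = (ThetaSetting.modelχ p).DeltaTemp ∧
      (ThetaSetting.modelχ p).GtpYdd.map Γ.toMulEquiv.toMonoidHom = (ThetaSetting.modelχ p).GtpYdd)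
    (h219iii : (C.thetaEnvTower τ hC hS).Cor219_iii) :
    (C.rigidData (τ.modAll M) hC hS h15 L).Cor218_iv_surjective :=
  C.rigidData_cor218_iv_surjective_modAll_of_extends τ M hC hS h15 h15ii L hext h219iii

/-- **[EtTh] Cor 2.18 (iv), bijectivity for `N/M` odd, at the record model tower, label-free**: conditional
on Prop 1.5 (ii), (iii), `hext` and `ThetaEnvTower.Cor219_iii` only (`hslimX`, `haugOpen`, `IsEtThOrigin`,
`hYcl` are theorems at `modelχ`). [cite: MochizukiEtTh2009, Cor 2.18(iv) p.62] -/
theorem cor218_iv_bijective_of_odd_modelχ_of_extends_facts (hC : (ThetaSetting.modelχ p).Compat)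
    (hS : (ThetaSetting.modelχ p).Sec2Hyps) (h15 : ThetaSetting.Prop15iii E hC)
    (h15ii : ThetaSetting.Prop15ii E.toKummerData hC)
    (hext : ∀ γ : ↥C.Huu ≃ₜ* ↥C.Huu, ∃ Γ : (ThetaSetting.modelχ p).PiTemp ≃ₜ* (ThetaSetting.modelχ p).PiTemp,
      (∀ h : C.Huu, Γ (h : (ThetaSetting.modelχ p).PiTemp) = ((γ h : C.Huu) : (ThetaSetting.modelχ p).PiTemp)) ∧
      (ThetaSetting.modelχ p).DeltaTemp.map Γ.toMulEquiv.toMonoidHom = (ThetaSetting.modelχ p).DeltaTemp ∧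
      (ThetaSetting.modelχ p).GtpYdd.map Γ.toMulEquiv.toMonoidHom = (ThetaSetting.modelχ p).GtpYdd)
    (h219iii : (C.thetaEnvTower τ hC hS).Cor219_iii) :
    (C.thetaEnvTower τ hC hS).Cor218_iv_bijective_of_odd :=
  C.cor218_iv_bijective_of_odd_of_model_of_core5_facts τ hC hS h15 h15ii
    ⟨fun _ => ∅, fun _ => ∅, fun _ => rfl⟩ (isSlimGroup_piTemp_modelχ p) (isOpenMap_aug_modelχ p)
    (fun e γ => C.rigidData_core5_of_extends (τ.mod e) hC hS h15 _ hext γ) h219iii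
    (ThetaSetting.modelχ_isEtThOrigin p) (hYcl_modelχ p)

/-! ## §3. Conversely, at the record model the `Π^tp_Ÿ`-clause is NOT idle -/

/-- **At the record model, Cor 2.18 (iv) surjectivity (at any level, any labelling) FORCES every
`γ ∈ Aut_top(Π^tp_X̲̲)` to map `Π^tp_Ÿ̲̲` onto itself and to preserve the cyclotomic character on `Π^tp_Y̲̲`**
— abc-iut-f-147's `RigidData.necessary_of_cor218_iv_surjective`, the `Π^tp_Y̲̲`-preservation hypothesis
being the theorem `rigidData_map_PiY_eq_modelχ` (abc-iut-f-148) there. So the `Π^tp_Ÿ`-part of the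
extension hypothesis of §2 cannot be dropped. [cite: MochizukiEtTh2009, Cor 2.18(iv) p.61] -/
theorem map_PiYdd_eq_of_cor218_iv_surjective_modelχ (hC : (ThetaSetting.modelχ p).Compat)
    (hS : (ThetaSetting.modelχ p).Sec2Hyps) (h15 : ThetaSetting.Prop15iii E hC) (L : C.CuspLabels)
    (h : (C.rigidData μ hC hS h15 L).Cor218_iv_surjective) (γ : ↥C.Huu ≃ₜ* ↥C.Huu) :
    (C.rigidData μ hC hS h15 L).PiYdd.map γ.toMulEquiv.toMonoidHom = (C.rigidData μ hC hS h15 L).PiYdd ∧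
      ∀ g : (C.rigidData μ hC hS h15 L).PiY,
        (C.rigidData μ hC hS h15 L).chi ((C.rigidData μ hC hS h15 L).aug (γ g)) =
          (C.rigidData μ hC hS h15 L).chi ((C.rigidData μ hC hS h15 L).aug g) :=
  C.rigidData_necessary_of_cor218_iv_surjective μ hC hS h15 L h γ
    (rigidData_map_PiY_eq_modelχ p C μ hC hS h15 L γ)

end SettingModel

end Literature.AnabelianGeometry.EtaleTheta

end
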